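import Summits.BirchSwinnertonDyer.BirchSwinnertonDyer.Theorems.ManinLocalTwoThreeManinOddAtFourKatoShiftLever

/-!
# Route `ManinLocalTwoThree`, crux C2 `ManinOddAtFour` (stmt-BirchSwinnertonDyer-22967), line `kato-shift-two`:
# the SHARP Euler-system step S2♯ and E-an-43 `KatoManinOddTwo` from the REAL-SUBFIELD form F-an-42 of the
# `p = 2` Kato fact (an g10, MEMO-an §54) — stub 4 (archimedean residual) becomes a corollary

TURNKEY for the lead prover (P-an-5; written by the -an WAKE seat, which lands nothing). GRANTED the `p = 2` Kato
fact in its real-subfield form `hK` — VERBATIM the body of `kato_neron_isIntegral_twistedSymbolSum_of_additive_two_polar`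
(F-es-21) with the factor `((if 0 < V.Δ then 2 else 1 : ℕ) : ℂ)` DELETED (F-an-42
`KatoNeronIsIntegralTwistedSymbolSumOfAdditiveTwoReal`, HOME/an/Sketch-an-g10.lean; derivation MEMO-an §54.3
(Q6)–(Q8): the zeta element of the `ι^*`-invariant class has `exp*` in `ℚ(ζ_m)⁺`, half-orbit resolvents are
`2`-integral in the Kosters–Pannekoek receptacle, `[ω]⁺ = (Ω(V)/2)·γ_ι` in both lattice shapes):
* `pint_charSumPlus_div_four_of_real` — the landed `pint_charSumPlus_div_four` with the `rcases hΔ` case split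
  replaced by its `Δ < 0` branch, now valid for both signs: `(Σ_a χ(a)x(a))/4` is `2`-integral at `2 ∣ c`;
* `exists_int_re_multiShiftClass_eq_two_mul_of_real` — the stub-2 conclusion WITHOUT `(W.Δ < 0 ∨ 4 ∣ D.c)`;
* `sharpStub_two_dvd_multiShiftClass` — the same in the registered shape (`AdmissiblePrimeTwo`, `multiShiftClass`)
  = S2♯ `SharpShiftStepTwo` of the sketch;
* `katoManinOddTwo_of_realKatoFact_of_generation` — **E-an-43**: granted `hK` and the multi-shift generation
  law E-es-22, every lattice-optimal datum with `4 ∣ N` and `W[2]` irreducible has ODD Manin constant (no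
  sign-of-`Δ` clause, no twist-orbit minimality) — the tree's `key` argument of `katoShiftTwistManinTwo_of_shiftStep`;
* corollaries: `KatoShiftTwistManinTwo` (E-es-21) and `ManinOddOfPosDiscAtFour` (E-es-23 (a) = stub 4's leaf) from
  the same two inputs, and the crux BY NAME from {`hK`, E-es-22, `ManinOddOfReducibleAtFour`} — three inputs
  instead of four.
Nothing about BSD is proved here; Manin's conjecture at `2` is NOT proved here (F-an-42 is a statement-only
reading awaiting the cell's re-derivation R-an-26 and typing T-an-16; E-es-22 and the reducible residual are open).
-/

set_option autoImplicit false
set_option linter.dupNamespace false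

noncomputable section

open scoped Classical MatrixGroups ModularForm

open CongruenceSubgroup Complex Literature.NumberTheory.EllipticCurves
  Literature.NumberTheory.EllipticCurves.ModularForms
  Summit.BirchSwinnertonDyer.Rank1Residual.ManinAdditive
  Summit.BirchSwinnertonDyer.BirchSwinnertonDyer.Theorems.ManinFrameResidueProperRTameTwist

namespace Summit.BirchSwinnertonDyer.BirchSwinnertonDyer.Theorems.ManinLocalTwoThree

section TwoStepReal

variable {W : WeierstrassCurve ℚ} [W.IsElliptic] [W.IsGloballyMinimal] {N : ℕ} [NeZero N]

/-- **One even character off the holes: `(Σ_a χ(a) x(a))/4` is `2`-integral at `2 ∣ c`, BOTH signs of `Δ`**,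
GRANTED the real-subfield `p = 2` Kato fact WITHOUT the `#π₀(V(ℝ))` factor `hK` (F-an-42, by value), at a
lattice-optimal datum of a curve additive at `2` with `W[2]` irreducible and `2 ∣ c` (NO sign-of-`Δ` / `4 ∣ c`
clause), for a prime `ℓ ∤ N`, `ℓ ≡ 3 (mod 4)`, an EVEN `χ` mod `ℓ` with `χ(8) ≠ 1` and `χ(q) ≠ 1` at every
`q ∥ N`. The landed `pint_charSumPlus_div_four` with its `rcases hΔ` split replaced by the former `Δ < 0` branch.
[cite: Kato2004Asterisque, Thm. 9.7 (p. 189)] [cite: KostersPannekoek2017, Thm. 1, §3.3.1] -/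
theorem pint_charSumPlus_div_four_of_real
    (hK : ∀ (V : WeierstrassCurve ℚ) [V.IsElliptic] [V.IsGloballyMinimal] {N : ℕ} [NeZero N]
      (f : CuspForm (Gamma0 N) 2) (_ : IsNewformOf V f)
      (_ : ¬ V.HasGoodReductionAtPrime 2) (_ : ¬ V.HasMultiplicativeReductionAtPrime 2)
      (_ : V.HasIrreducibleModPGaloisRep 2) (m : ℕ) [NeZero m] (_ : m.Coprime (2 * N))
      (χ : DirichletCharacter ℂ m) (_ : χ.IsPrimitive) (_ : χ ≠ 1) (_ : ¬ 2 ∣ orderOf χ)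
      (_ : χ (8 : ZMod m) ≠ 1) (ϖ : ℚ) (r : ℂ),
      (ϖ : ℝ) * V.realPeriodRat = plusPeriod f →
        (∏ ℓ ∈ N.primeFactors with ¬ ℓ ^ 2 ∣ N,
            (((ℓ : ℂ) - (V.LFunction ℓ : ℂ) * χ (ℓ : ZMod m)) *
              ((ℓ : ℂ) - (V.LFunction ℓ : ℂ) * (χ (ℓ : ZMod m))⁻¹))) *
          twistedSymbolSum f χ = r * (plusPeriod f : ℂ) →
        ∃ s : ℕ, ¬ 2 ∣ s ∧ IsIntegral ℤ ((s : ℂ) * ϖ * r))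
    (D : ModularParametrizationData W N)
    (hopt : ∀ z ∈ D.L.lattice, ∃ w ∈ periodLattice D.f, z = D.c * w)
    (hadd : ¬ W.HasGoodReductionAtPrime 2 ∧ ¬ W.HasMultiplicativeReductionAtPrime 2)
    (hirr : W.HasIrreducibleModPGaloisRep 2) (h2c : (2 : ℤ) ∣ D.c)
    (h4 : 2 ^ 2 ∣ N) {ℓ : ℕ} (hℓ : ℓ.Prime) (hℓN : ¬ ℓ ∣ N) (h4ℓ : ℓ % 4 = 3)
    {x : ZMod ℓ → ℤ}
    (hx : ∀ v : ZMod ℓ, (modularSymbol D.f (((v.val : ℕ) : ℚ) / ℓ) - modularSymbol D.f 0).re =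
      x v * (plusPeriod D.f / 2))
    (χ : DirichletCharacter ℂ ℓ) (hχ : χ.Even) (hχ8 : χ (8 : ZMod ℓ) ≠ 1)
    (hholes : ∀ q ∈ N.primeFactors, ¬ q ^ 2 ∣ N → χ (q : ZMod ℓ) ≠ 1) :
    haveI : NeZero ℓ := ⟨hℓ.ne_zero⟩
    ∃ s : ℕ, ¬ 2 ∣ s ∧ IsIntegral ℤ ((s : ℂ) * ((∑ a : ZMod ℓ, χ a * (x a : ℂ)) / 4)) := by
  haveI : NeZero ℓ := ⟨hℓ.ne_zero⟩
  haveI : Fact ℓ.Prime := ⟨hℓ⟩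
  have hℓ2 : ℓ ≠ 2 := by omega
  have hreal : ∀ n, (cuspCoeff D.f n).im = 0 :=
    cuspCoeff_im_eq_zero_of_coeffField_eq_bot D.isNewformOf.coeffField_eq_bot
  have hΩf : 0 < plusPeriod D.f :=
    IsNewform0.plusPeriod_pos_holds D.isNewformOf.1 D.isNewformOf.coeffField_eq_bot
  have hc0 : D.c ≠ 0 := D.maninConstant_ne_zero_holds
  -- `χ ≠ 1`, odd order, primitive
  have h8u : IsUnit (8 : ZMod ℓ) := by
    have : (8 : ZMod ℓ) = ((2 ^ 3 : ℕ) : ZMod ℓ) := by norm_num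
    rw [this, ZMod.isUnit_iff_coprime]
    exact Nat.Coprime.pow_left 3 ((Nat.coprime_primes Nat.prime_two hℓ).mpr hℓ2.symm)
  have hχ1 : χ ≠ 1 := by
    intro h; apply hχ8; rw [h, MulChar.one_apply h8u]
  have hord : ¬ 2 ∣ orderOf χ := not_two_dvd_orderOf_of_even h4ℓ hχ
  have hprim : χ.IsPrimitive := isPrimitive_of_ne_one hχ1
  have hm : ℓ.Coprime (2 * N) := Nat.Coprime.mul_right
    ((Nat.coprime_primes hℓ Nat.prime_two).mpr hℓ2) ((hℓ.coprime_iff_not_dvd).mpr hℓN)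
  -- `Ω(W) = |c|·Ω⁺_f`, `ϖ = 1/|c|`
  have hΩW : W.realPeriodRat = |(D.c : ℝ)| * plusPeriod D.f :=
    D.realPeriodRat_eq_abs_mul_plusPeriod_of_latticeEq hopt
  set cabs : ℤ := |D.c| with hcabs
  have hcabs0 : cabs ≠ 0 := abs_ne_zero.mpr hc0
  set ϖ : ℚ := 1 / (cabs : ℚ) with hϖdef
  have hϖ : (ϖ : ℝ) * W.realPeriodRat = plusPeriod D.f := by
    rw [hϖdef, hΩW]; push_cast; rw [hcabs, Int.cast_abs]
    have : |(D.c : ℝ)| ≠ 0 := abs_ne_zero.mpr (by exact_mod_cast hc0)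
    field_simp
  -- `T = (Ω⁺/2)·A`
  set A : ℂ := ∑ a : ZMod ℓ, χ a * (x a : ℂ) with hAdef
  set E : ℂ := ∏ q ∈ N.primeFactors with ¬ q ^ 2 ∣ N,
      (((q : ℂ) - (W.LFunction q : ℂ) * χ (q : ZMod ℓ)) *
        ((q : ℂ) - (W.LFunction q : ℂ) * (χ (q : ZMod ℓ))⁻¹)) with hEdef
  have hT : twistedSymbolSum D.f χ = ((plusPeriod D.f / 2 : ℝ) : ℂ) * A := by
    have hpt : ∀ v : ZMod ℓ, χ v *
        (((modularSymbol D.f (((v.val : ℕ) : ℚ) / ℓ) - modularSymbol D.f 0).re : ℝ) : ℂ) =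
        ((plusPeriod D.f / 2 : ℝ) : ℂ) * (χ v * (x v : ℂ)) := by
      intro v; rw [hx v]; push_cast; ring
    rw [twistedSymbolSum_eq_sum_re_of_even D.f hℓ.ne_zero hreal χ hχ hχ1,
      Finset.sum_congr rfl (fun v _ ↦ hpt v), ← Finset.mul_sum]
  set r : ℂ := E * A / 2 with hrdef
  have hval : E * twistedSymbolSum D.f χ = r * (plusPeriod D.f : ℂ) := by
    rw [hT, hrdef]; push_cast; ring
  obtain ⟨s, hs, hint⟩ := hK W D.f D.isNewformOf hadd.1 hadd.2 hirr ℓ hm χ hprim hχ1 hord hχ8 ϖ r hϖ hval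
  have hcabsC : ((cabs : ℤ) : ℂ) ≠ 0 := by exact_mod_cast hcabs0
  have hϖC : (ϖ : ℂ) = 1 / ((cabs : ℤ) : ℂ) := by rw [hϖdef]; push_cast; rfl
  -- `s·ϖ·r = s·E·A/(2|c|)`; `|c| = 2|k|`: multiply by `|k|` to get `s·E·(A/4)` integral (no `π₀`, no case split)
  have hint2 : IsIntegral ℤ ((s : ℂ) * (E * (A / 4))) := by
    obtain ⟨k, hk⟩ := h2c
    have hk0 : k ≠ 0 := by rintro rfl; exact hc0 (by rw [hk, mul_zero])
    have habs : cabs = 2 * |k| := by rw [hcabs, hk, abs_mul]; norm_num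
    have hkC : ((|k| : ℤ) : ℂ) ≠ 0 := by exact_mod_cast (abs_ne_zero.mpr hk0)
    have hkey : (((|k| : ℤ)) : ℂ) * ((s : ℂ) * (ϖ : ℂ) * r) = (s : ℂ) * (E * (A / 4)) := by
      rw [hϖC, hrdef, habs]; push_cast; field_simp; try ring
    rw [← hkey]
    exact (isIntegral_algebraMap (R := ℤ) (x := (|k| : ℤ))).mul hint
  have hpintEA : ∃ s : ℕ, ¬ 2 ∣ s ∧ IsIntegral ℤ ((s : ℂ) * (E * (A / 4))) := ⟨s, hs, hint2⟩
  -- cancel the `2`-unit `E`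
  obtain ⟨w, t, hw, hEw, ht⟩ : ∃ (w : ℂ) (t : ℤ), IsIntegral ℤ w ∧ E * w = t ∧ ¬ ((2 : ℕ) : ℤ) ∣ t := by
    refine exists_prod_mul_eq Nat.prime_two _ _ fun q hq ↦ ?_
    obtain ⟨hqN, hq2⟩ := Finset.mem_filter.mp hq
    have hqp : q.Prime := Nat.prime_of_mem_primeFactors hqN
    have hqne2 : q ≠ 2 := by rintro rfl; exact hq2 h4
    have hqℓ : q ≠ ℓ := by rintro rfl; exact hℓN (Nat.dvd_of_mem_primeFactors hqN)
    have hqu : IsUnit ((q : ℕ) : ZMod ℓ) := by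
      rw [ZMod.isUnit_iff_coprime]
      exact (Nat.coprime_primes hqp hℓ).mpr hqℓ
    have ha : W.LFunction q = 1 ∨ W.LFunction q = -1 ∨ W.LFunction q = 0 :=
      lFunction_eq_one_or_neg_one_or_zero_of_dvd_level D.isNewformOf hqp (Nat.dvd_of_mem_primeFactors hqN)
    exact exists_symmEulerFactor_mul_eq_two hqp hqne2 hqu ha hord (hholes q hqN hq2)
  exact pint_of_pint_mul_of_mul_eq Nat.prime_two hw hEw ht hpintEA

/-- **Stub-2 conclusion WITHOUT the side condition `(Δ < 0 ∨ 4 ∣ c)`**, granted the real-subfield `p = 2`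
Kato fact `hK` (F-an-42, by value): at a lattice-optimal `X₀(N)`-datum `D` of a globally minimal `W` with
`4 ∣ N`, `W` additive at `2`, `W[2]` irreducible and `2 ∣ c`, for every admissible `ℓ` and `0 < a < ℓ`:
`Re(Σ_{T ⊆ Gen(N)} (−1)^{|T|} ({∞, a∏T/ℓ}_f − {∞,0}_f)) = 2n·(Ω⁺_f/2)`.
[cite: Kato2004Asterisque, Thm. 9.7 (p. 189)] [cite: KostersPannekoek2017, Thm. 1, §3.3.1] -/
theorem exists_int_re_multiShiftClass_eq_two_mul_of_real
    (hK : ∀ (V : WeierstrassCurve ℚ) [V.IsElliptic] [V.IsGloballyMinimal] {N : ℕ} [NeZero N]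
      (f : CuspForm (Gamma0 N) 2) (_ : IsNewformOf V f)
      (_ : ¬ V.HasGoodReductionAtPrime 2) (_ : ¬ V.HasMultiplicativeReductionAtPrime 2)
      (_ : V.HasIrreducibleModPGaloisRep 2) (m : ℕ) [NeZero m] (_ : m.Coprime (2 * N))
      (χ : DirichletCharacter ℂ m) (_ : χ.IsPrimitive) (_ : χ ≠ 1) (_ : ¬ 2 ∣ orderOf χ)
      (_ : χ (8 : ZMod m) ≠ 1) (ϖ : ℚ) (r : ℂ),
      (ϖ : ℝ) * V.realPeriodRat = plusPeriod f →
        (∏ ℓ ∈ N.primeFactors with ¬ ℓ ^ 2 ∣ N,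
            (((ℓ : ℂ) - (V.LFunction ℓ : ℂ) * χ (ℓ : ZMod m)) *
              ((ℓ : ℂ) - (V.LFunction ℓ : ℂ) * (χ (ℓ : ZMod m))⁻¹))) *
          twistedSymbolSum f χ = r * (plusPeriod f : ℂ) →
        ∃ s : ℕ, ¬ 2 ∣ s ∧ IsIntegral ℤ ((s : ℂ) * ϖ * r))
    (D : ModularParametrizationData W N)
    (hopt : ∀ z ∈ D.L.lattice, ∃ w ∈ periodLattice D.f, z = D.c * w) (h4 : 2 ^ 2 ∣ N)
    (hadd : ¬ W.HasGoodReductionAtPrime 2 ∧ ¬ W.HasMultiplicativeReductionAtPrime 2)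
    (hirr : W.HasIrreducibleModPGaloisRep 2) (h2c : (2 : ℤ) ∣ D.c)
    {ℓ : ℕ} (hℓ : ℓ.Prime) (hℓN : ¬ ℓ ∣ N) (h4ℓ : ℓ % 4 = 3)
    (hgen : ∀ t ∈ insert 8 (N.primeFactors.filter fun q ↦ ¬ q ^ 2 ∣ N),
      (t : ZMod ℓ) ≠ 1 ∧ (t : ZMod ℓ) ≠ -1)
    (a : ℕ) (ha0 : 0 < a) (haℓ : a < ℓ) :
    ∃ n : ℤ, (∑ T ∈ (insert 8 (N.primeFactors.filter fun q ↦ ¬ q ^ 2 ∣ N)).powerset,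
        (-1 : ℂ) ^ T.card *
          (modularSymbol D.f (((a * ∏ t ∈ T, t : ℕ) : ℚ) / ℓ) - modularSymbol D.f 0)).re =
      2 * n * (plusPeriod D.f / 2) := by
  haveI : NeZero ℓ := ⟨hℓ.ne_zero⟩
  haveI : Fact ℓ.Prime := ⟨hℓ⟩
  have hℓ2 : ℓ ≠ 2 := by omega
  set Gen : Finset ℕ := insert 8 (N.primeFactors.filter fun q ↦ ¬ q ^ 2 ∣ N) with hGen
  obtain ⟨x, hx, heven⟩ := exists_latticeCoordPlus D hℓ hℓN
  -- the hole generators as units mod `ℓ`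
  have hcop : ∀ t ∈ Gen, Nat.Coprime t ℓ := by
    intro t ht
    rw [hGen, Finset.mem_insert, Finset.mem_filter] at ht
    rcases ht with rfl | ⟨htN, _⟩
    · exact Nat.Coprime.pow_left 3 ((Nat.coprime_primes Nat.prime_two hℓ).mpr hℓ2.symm)
    · have htp : t.Prime := Nat.prime_of_mem_primeFactors htN
      have htℓ : t ≠ ℓ := by rintro rfl; exact hℓN (Nat.dvd_of_mem_primeFactors htN)
      exact (Nat.coprime_primes htp hℓ).mpr htℓ
  let g : ℕ → (ZMod ℓ)ˣ := fun t ↦ if h : Nat.Coprime t ℓ then ZMod.unitOfCoprime t h else 1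
  have hg : ∀ t ∈ Gen, ((g t : (ZMod ℓ)ˣ) : ZMod ℓ) = (t : ZMod ℓ) := by
    intro t ht
    simp only [g, dif_pos (hcop t ht), ZMod.coe_unitOfCoprime]
  -- the unit `a`
  have hacop : Nat.Coprime a ℓ :=
    Nat.Coprime.symm ((Nat.Prime.coprime_iff_not_dvd hℓ).mpr (Nat.not_dvd_of_pos_of_lt ha0 haℓ))
  set β : (ZMod ℓ)ˣ := ZMod.unitOfCoprime a hacop with hβ
  have hβa : (β : ZMod ℓ) = (a : ZMod ℓ) := by rw [hβ, ZMod.coe_unitOfCoprime]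
  -- the Kato input for `two_dvd_multiShift_of_pint'`
  have hA : ∀ χ : DirichletCharacter ℂ ℓ, χ.Even → (∀ t ∈ Gen, χ (g t : ZMod ℓ) ≠ 1) →
      ∃ n : ℕ, ¬ 2 ∣ n ∧ IsIntegral ℤ ((n : ℂ) * ((∑ w : ZMod ℓ, χ w * (x w : ℂ)) / 4)) := by
    intro χ hχ hholes
    have h8 : χ (8 : ZMod ℓ) ≠ 1 := by
      have := hholes 8 (by rw [hGen]; exact Finset.mem_insert_self _ _)
      rw [hg 8 (by rw [hGen]; exact Finset.mem_insert_self _ _)] at this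
      exact_mod_cast this
    have hq : ∀ q ∈ N.primeFactors, ¬ q ^ 2 ∣ N → χ (q : ZMod ℓ) ≠ 1 := by
      intro q hqN hq2
      have hmem : q ∈ Gen := by
        rw [hGen, Finset.mem_insert, Finset.mem_filter]; exact Or.inr ⟨hqN, hq2⟩
      have := hholes q hmem
      rwa [hg q hmem] at this
    exact pint_charSumPlus_div_four_of_real hK D hopt hadd hirr h2c h4 hℓ hℓN h4ℓ hx χ hχ h8 hq
  obtain ⟨n, hn⟩ := two_dvd_multiShift_of_pint' h4ℓ x heven Gen g hA β
  refine ⟨n, ?_⟩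
  -- rewrite each class through `x`
  have hterm : ∀ T ∈ Gen.powerset,
      ((-1 : ℂ) ^ T.card *
        (modularSymbol D.f (((a * ∏ t ∈ T, t : ℕ) : ℚ) / ℓ) - modularSymbol D.f 0)).re =
      ((-1 : ℤ) ^ T.card * x ((β : ZMod ℓ) * ((∏ i ∈ T, g i : (ZMod ℓ)ˣ) : ZMod ℓ)) : ℝ) *
        (plusPeriod D.f / 2) := by
    intro T hT
    have hTsub : T ⊆ Gen := Finset.mem_powerset.mp hT
    have h1 : modularSymbol D.f (((a * ∏ t ∈ T, t : ℕ) : ℚ) / ℓ) =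
        modularSymbol D.f (((((a * ∏ t ∈ T, t : ℕ) : ZMod ℓ).val : ℕ) : ℚ) / ℓ) := by
      have := modularSymbol_div_eq_of_intCast D.f hℓ.ne_zero ((a * ∏ t ∈ T, t : ℕ) : ℤ)
      rw [Int.cast_natCast] at this
      rw [this]; push_cast; ring_nf
    have h2 : ((a * ∏ t ∈ T, t : ℕ) : ZMod ℓ) = (β : ZMod ℓ) * ((∏ i ∈ T, g i : (ZMod ℓ)ˣ) : ZMod ℓ) := by
      rw [hβa, Units.coe_prod]; push_cast
      congr 1
      exact Finset.prod_congr rfl fun t ht ↦ (hg t (hTsub ht)).symm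
    have hre : ((-1 : ℂ) ^ T.card *
        (modularSymbol D.f (((a * ∏ t ∈ T, t : ℕ) : ℚ) / ℓ) - modularSymbol D.f 0)).re =
        (-1 : ℝ) ^ T.card *
          (modularSymbol D.f (((a * ∏ t ∈ T, t : ℕ) : ℚ) / ℓ) - modularSymbol D.f 0).re := by
      rw [show ((-1 : ℂ) ^ T.card) = (((-1 : ℝ) ^ T.card : ℝ) : ℂ) by push_cast; ring,
        Complex.re_ofReal_mul]
    rw [hre, h1, hx, h2]; push_cast; ring
  rw [Complex.re_sum, Finset.sum_congr rfl hterm, ← Finset.sum_mul]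
  have hn' := congrArg (fun z : ℤ ↦ (z : ℝ)) hn
  push_cast at hn' ⊢
  rw [hn']

end TwoStepReal

section LeverTwoReal

/-- **S2♯ in the registered shape** (`AdmissiblePrimeTwo`, `multiShiftClass`; = `SharpShiftStepTwo` of
HOME/an/Sketch-an-g10.lean): the stub `stub_two_dvd_multiShiftClass` WITHOUT `(W.Δ < 0 ∨ 4 ∣ D.c)`, granted the
real-subfield fact. [cite: Kato2004Asterisque, Thm. 9.7 (p. 189)] [cite: KostersPannekoek2017, Thm. 1, §3.3.1] -/
theorem sharpStub_two_dvd_multiShiftClass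
    (hK : ∀ (V : WeierstrassCurve ℚ) [V.IsElliptic] [V.IsGloballyMinimal] {N : ℕ} [NeZero N]
      (f : CuspForm (Gamma0 N) 2) (_ : IsNewformOf V f)
      (_ : ¬ V.HasGoodReductionAtPrime 2) (_ : ¬ V.HasMultiplicativeReductionAtPrime 2)
      (_ : V.HasIrreducibleModPGaloisRep 2) (m : ℕ) [NeZero m] (_ : m.Coprime (2 * N))
      (χ : DirichletCharacter ℂ m) (_ : χ.IsPrimitive) (_ : χ ≠ 1) (_ : ¬ 2 ∣ orderOf χ)
      (_ : χ (8 : ZMod m) ≠ 1) (ϖ : ℚ) (r : ℂ),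
      (ϖ : ℝ) * V.realPeriodRat = plusPeriod f →
        (∏ ℓ ∈ N.primeFactors with ¬ ℓ ^ 2 ∣ N,
            (((ℓ : ℂ) - (V.LFunction ℓ : ℂ) * χ (ℓ : ZMod m)) *
              ((ℓ : ℂ) - (V.LFunction ℓ : ℂ) * (χ (ℓ : ZMod m))⁻¹))) *
          twistedSymbolSum f χ = r * (plusPeriod f : ℂ) →
        ∃ s : ℕ, ¬ 2 ∣ s ∧ IsIntegral ℤ ((s : ℂ) * ϖ * r)) :
    ∀ (W : WeierstrassCurve ℚ) [W.IsElliptic] [W.IsGloballyMinimal] {N : ℕ} [NeZero N]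
      (D : ModularParametrizationData W N),
      (∀ z ∈ D.L.lattice, ∃ w ∈ periodLattice D.f, z = D.c * w) → 2 ^ 2 ∣ N →
      ¬ W.HasGoodReductionAtPrime 2 → ¬ W.HasMultiplicativeReductionAtPrime 2 →
      W.HasIrreducibleModPGaloisRep 2 → (2 : ℤ) ∣ D.c →
      ∀ ℓ : ℕ, AdmissiblePrimeTwo N ℓ → ∀ a : ℕ, 0 < a → a < ℓ →
        ∃ n : ℤ, (multiShiftClass D.f ℓ a).re = 2 * n * (plusPeriod D.f / 2) := by
  intro W _ _ N _ D hopt h4 hg hm hirr h2c ℓ hadm a ha0 haℓ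
  obtain ⟨hℓ, hℓN, h4ℓ, hgen⟩ := hadm
  exact exists_int_re_multiShiftClass_eq_two_mul_of_real hK D hopt h4 ⟨hg, hm⟩ hirr h2c hℓ hℓN h4ℓ hgen a ha0 haℓ

/-- **E-an-43 `KatoManinOddTwo` ⟸ the real-subfield `p = 2` Kato fact ∧ the multi-shift generation law E-es-22**:
every lattice-optimal `X₀(N)`-datum with `4 ∣ N` and `W[2]` irreducible has ODD Manin constant — no sign-of-`Δ`
clause. The tree's `key` argument of `katoShiftTwistManinTwo_of_shiftStep` (`additive_of_four_dvd_level`,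
`multiShiftClassGenerationTwo_iff`, `functional_nonvanishing_gen_re`) with the side condition gone.
[cite: Kato2004Asterisque, Thm. 9.7 (p. 189)] -/
theorem katoManinOddTwo_of_realKatoFact_of_generation
    (hK : ∀ (V : WeierstrassCurve ℚ) [V.IsElliptic] [V.IsGloballyMinimal] {N : ℕ} [NeZero N]
      (f : CuspForm (Gamma0 N) 2) (_ : IsNewformOf V f)
      (_ : ¬ V.HasGoodReductionAtPrime 2) (_ : ¬ V.HasMultiplicativeReductionAtPrime 2)
      (_ : V.HasIrreducibleModPGaloisRep 2) (m : ℕ) [NeZero m] (_ : m.Coprime (2 * N))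
      (χ : DirichletCharacter ℂ m) (_ : χ.IsPrimitive) (_ : χ ≠ 1) (_ : ¬ 2 ∣ orderOf χ)
      (_ : χ (8 : ZMod m) ≠ 1) (ϖ : ℚ) (r : ℂ),
      (ϖ : ℝ) * V.realPeriodRat = plusPeriod f →
        (∏ ℓ ∈ N.primeFactors with ¬ ℓ ^ 2 ∣ N,
            (((ℓ : ℂ) - (V.LFunction ℓ : ℂ) * χ (ℓ : ZMod m)) *
              ((ℓ : ℂ) - (V.LFunction ℓ : ℂ) * (χ (ℓ : ZMod m))⁻¹))) *
          twistedSymbolSum f χ = r * (plusPeriod f : ℂ) →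
        ∃ s : ℕ, ¬ 2 ∣ s ∧ IsIntegral ℤ ((s : ℂ) * ϖ * r))
    (hG : MultiShiftClassGenerationTwo) :
    ∀ (W : WeierstrassCurve ℚ) [W.IsElliptic] [W.IsGloballyMinimal] {N : ℕ} [NeZero N]
      (D : ModularParametrizationData W N),
      (∀ z ∈ D.L.lattice, ∃ w ∈ periodLattice D.f, z = D.c * w) → 2 ^ 2 ∣ N →
      W.HasIrreducibleModPGaloisRep 2 → ¬ (2 : ℤ) ∣ D.c := by
  intro W _ _ N _ D hopt h4 hirr h2
  obtain ⟨hg, hm⟩ := additive_of_four_dvd_level W D.f D.isNewformOf h4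
  obtain ⟨m, hm2, hspan⟩ := (multiShiftClassGenerationTwo_iff.mp hG) W D.f 0 D.isNewformOf h4 hirr
  have hpos : 0 < plusPeriod D.f :=
    IsNewform0.plusPeriod_pos_holds D.isNewformOf.1 D.isNewformOf.coeffField_eq_bot
  refine functional_nonvanishing_gen_re D.f
    {z | ∃ ℓ ∈ {ℓ | 0 ≤ ℓ ∧ AdmissiblePrimeTwo N ℓ}, ∃ a : ℕ, 0 < a ∧ a < ℓ ∧ z = multiShiftClass D.f ℓ a}
    m hm2 hpos hspan ?_
  rintro t ⟨ℓ, hℓ, a, ha1, ha2, rfl⟩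
  exact sharpStub_two_dvd_multiShiftClass hK W D hopt h4 hg hm hirr h2 ℓ hℓ.2 a ha1 ha2

/-- **E-es-21 `KatoShiftTwistManinTwo` from the real-subfield fact ∧ E-es-22** (corollary of E-an-43).
[cite: Kato2004Asterisque, Thm. 9.7 (p. 189)] -/
theorem katoShiftTwistManinTwo_of_realKatoFact_of_generation
    (hK : ∀ (V : WeierstrassCurve ℚ) [V.IsElliptic] [V.IsGloballyMinimal] {N : ℕ} [NeZero N]
      (f : CuspForm (Gamma0 N) 2) (_ : IsNewformOf V f)
      (_ : ¬ V.HasGoodReductionAtPrime 2) (_ : ¬ V.HasMultiplicativeReductionAtPrime 2)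
      (_ : V.HasIrreducibleModPGaloisRep 2) (m : ℕ) [NeZero m] (_ : m.Coprime (2 * N))
      (χ : DirichletCharacter ℂ m) (_ : χ.IsPrimitive) (_ : χ ≠ 1) (_ : ¬ 2 ∣ orderOf χ)
      (_ : χ (8 : ZMod m) ≠ 1) (ϖ : ℚ) (r : ℂ),
      (ϖ : ℝ) * V.realPeriodRat = plusPeriod f →
        (∏ ℓ ∈ N.primeFactors with ¬ ℓ ^ 2 ∣ N,
            (((ℓ : ℂ) - (V.LFunction ℓ : ℂ) * χ (ℓ : ZMod m)) *
              ((ℓ : ℂ) - (V.LFunction ℓ : ℂ) * (χ (ℓ : ZMod m))⁻¹))) *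
          twistedSymbolSum f χ = r * (plusPeriod f : ℂ) →
        ∃ s : ℕ, ¬ 2 ∣ s ∧ IsIntegral ℤ ((s : ℂ) * ϖ * r))
    (hG : MultiShiftClassGenerationTwo) : KatoShiftTwistManinTwo := by
  intro W _ _ N _ D hopt h4 hirr
  have h := katoManinOddTwo_of_realKatoFact_of_generation hK hG W D hopt h4 hirr
  exact ⟨fun h4c => h (dvd_trans ⟨2, by norm_num⟩ h4c), fun _ => h⟩

/-- **The archimedean residual E-es-23 (a) `ManinOddOfPosDiscAtFour` — hence stub 4
`stub_minimalRealComponentsResidual` of the line — is a COROLLARY of the real-subfield fact ∧ E-es-22.**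
[cite: Kato2004Asterisque, Thm. 9.7 (p. 189)] -/
theorem maninOddOfPosDiscAtFour_of_realKatoFact_of_generation
    (hK : ∀ (V : WeierstrassCurve ℚ) [V.IsElliptic] [V.IsGloballyMinimal] {N : ℕ} [NeZero N]
      (f : CuspForm (Gamma0 N) 2) (_ : IsNewformOf V f)
      (_ : ¬ V.HasGoodReductionAtPrime 2) (_ : ¬ V.HasMultiplicativeReductionAtPrime 2)
      (_ : V.HasIrreducibleModPGaloisRep 2) (m : ℕ) [NeZero m] (_ : m.Coprime (2 * N))
      (χ : DirichletCharacter ℂ m) (_ : χ.IsPrimitive) (_ : χ ≠ 1) (_ : ¬ 2 ∣ orderOf χ)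
      (_ : χ (8 : ZMod m) ≠ 1) (ϖ : ℚ) (r : ℂ),
      (ϖ : ℝ) * V.realPeriodRat = plusPeriod f →
        (∏ ℓ ∈ N.primeFactors with ¬ ℓ ^ 2 ∣ N,
            (((ℓ : ℂ) - (V.LFunction ℓ : ℂ) * χ (ℓ : ZMod m)) *
              ((ℓ : ℂ) - (V.LFunction ℓ : ℂ) * (χ (ℓ : ZMod m))⁻¹))) *
          twistedSymbolSum f χ = r * (plusPeriod f : ℂ) →
        ∃ s : ℕ, ¬ 2 ∣ s ∧ IsIntegral ℤ ((s : ℂ) * ϖ * r))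
    (hG : MultiShiftClassGenerationTwo) : ManinOddOfPosDiscAtFour := by
  intro W _ _ N _ D hopt h4 hirr _ _
  exact katoManinOddTwo_of_realKatoFact_of_generation hK hG W D hopt h4 hirr

/-- **The crux C2 BY NAME from THREE inputs**: the real-subfield `p = 2` Kato fact (F-an-42, by value), the
multi-shift generation law E-es-22 and the reducible residual E-es-23 (b) — the archimedean residual is no longer
an input. A `proof.conditional`, not a closure. [cite: Kato2004Asterisque, Thm. 9.7 (p. 189)] -/
theorem maninOddAtFour_of_realKatoFact_of_generation_of_reducible
    (hK : ∀ (V : WeierstrassCurve ℚ) [V.IsElliptic] [V.IsGloballyMinimal] {N : ℕ} [NeZero N]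
      (f : CuspForm (Gamma0 N) 2) (_ : IsNewformOf V f)
      (_ : ¬ V.HasGoodReductionAtPrime 2) (_ : ¬ V.HasMultiplicativeReductionAtPrime 2)
      (_ : V.HasIrreducibleModPGaloisRep 2) (m : ℕ) [NeZero m] (_ : m.Coprime (2 * N))
      (χ : DirichletCharacter ℂ m) (_ : χ.IsPrimitive) (_ : χ ≠ 1) (_ : ¬ 2 ∣ orderOf χ)
      (_ : χ (8 : ZMod m) ≠ 1) (ϖ : ℚ) (r : ℂ),
      (ϖ : ℝ) * V.realPeriodRat = plusPeriod f →
        (∏ ℓ ∈ N.primeFactors with ¬ ℓ ^ 2 ∣ N,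
            (((ℓ : ℂ) - (V.LFunction ℓ : ℂ) * χ (ℓ : ZMod m)) *
              ((ℓ : ℂ) - (V.LFunction ℓ : ℂ) * (χ (ℓ : ZMod m))⁻¹))) *
          twistedSymbolSum f χ = r * (plusPeriod f : ℂ) →
        ∃ s : ℕ, ¬ 2 ∣ s ∧ IsIntegral ℤ ((s : ℂ) * ϖ * r))
    (hG : MultiShiftClassGenerationTwo) (hRb : ManinOddOfReducibleAtFour) :
    Summit.BirchSwinnertonDyer.BirchSwinnertonDyer.Theses.ManinLocalTwoThree.ManinOddAtFour :=
  maninOddAtFour_of_katoShift_of_residuals (katoShiftTwistManinTwo_of_realKatoFact_of_generation hK hG)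
    (maninOddOfPosDiscAtFour_of_realKatoFact_of_generation hK hG) hRb

end LeverTwoReal

end Summit.BirchSwinnertonDyer.BirchSwinnertonDyer.Theorems.ManinLocalTwoThree

end
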